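import Summits.KontsevichZagierPeriods.KontsevichZagierPeriods.Theses.Grothendieck
import Literature.NumberTheory.Transcendental.MZVSimplexRep
import Literature.Barriers.KontsevichZagierPeriods.GrothendieckPeriodConjectureDependence

/-!
# Sketch — crux-ideate stmt-KontsevichZagierPeriods-11102 (`SectorComplement`), round 1, ideator 3

Typed FIRST LEMMAS of three crux idea cards (no proofs; every `def … : Prop` elaborates over existing
declarations). Cards: `legendre-pencil-lossless` (§1), `relation-lattice-cofinality` (§2),
`containment-join` (§3).
-/

noncomputable section

set_option linter.dupNamespace false

namespace Summit.KontsevichZagierPeriods.KontsevichZagierPeriods.Cruxes.SectorComplement.SketchIdeator3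

open scoped BigOperators
open Set MeasureTheory
open Literature.NumberTheory.Transcendental
open Literature.NumberTheory.Transcendental.KZ
open Summit.KontsevichZagierPeriods.KontsevichZagierPeriods.Theses.Grothendieck

/-! ## §1 `legendre-pencil-lossless` -/

/-- `k_s(t) = 1/√((1−t²)(1−s t²))` (first-kind kernel at modulus `k² = s`). -/
def kfun (s t : ℝ) : ℝ := 1 / Real.sqrt ((1 - t ^ 2) * (1 - s * t ^ 2))

/-- `e_s(t) = √(1−s t²)/√(1−t²)` (second-kind kernel). -/
def efun (s t : ℝ) : ℝ := Real.sqrt (1 - s * t ^ 2) / Real.sqrt (1 - t ^ 2)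

/-- `K(s) = ∫₀¹ k_s`, `E(s) = ∫₀¹ e_s` (complete elliptic integrals, `k² = s`). -/
def Kval (s : ℝ) : ℝ := ∫ t in Ioo (0:ℝ) 1, kfun s t

def Eval (s : ℝ) : ℝ := ∫ t in Ioo (0:ℝ) 1, efun s t

/-- The Legendre integrand at modulus `k² = s`: `e_s(x)k_{1−s}(y) + e_{1−s}(x)k_s(y) − k_s(x)k_{1−s}(y)`,
whose integral over `(0,1)²` is `E K' + E' K − K K' = π/2`. At `s = 1/2` it is the integrand of crux 0280. -/
def legIntegrand (s x y : ℝ) : ℝ :=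
  efun s x * kfun (1 - s) y + efun (1 - s) x * kfun s y - kfun s x * kfun (1 - s) y

/-- **LegendreAt s**: Legendre's relation at the rational modulus `k² = s` as ONE equivalence
`[(0,1)², legIntegrand s] ~ [ℝ, 1/(2(1+x²))]` (generalises `GpcLegendreLemniscatic`, `s = 1/2`). -/
def LegendreAt (s : ℚ) : Prop :=
  ∀ (r : IntegralRep 2) (r' : IntegralRep 1),
    r.domain = {x | ∀ i, x i ∈ Ioo (0:ℝ) 1} →
    EqOn r.integrand (fun x => legIntegrand (s : ℝ) (x 0) (x 1)) r.domain →
    r'.domain = univ → EqOn r'.integrand (fun x => 1 / (2 * (1 + x 0 ^ 2))) r'.domain →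
    Equivalent r r'

/-- The five base kernels of the fibre ring at modulus `s`: `k_s, k_{1−s}, e_s, e_{1−s}` (values
`K, K', E, E'`) and the Cauchy kernel `1/(1+t²)` (value `π` over `ℝ`). -/
def base (s : ℝ) : Fin 5 → ℝ → ℝ :=
  ![kfun s, kfun (1 - s), efun s, efun (1 - s), fun t => 1 / (1 + t ^ 2)]

/-- **PencilFibreKernel s**: Conjecture 1 in kernel form on the fibre ring `ℤ[K, K', E, E', π](s)`:
every monomial is ONE representation — coordinates coloured by `τ : Fin N → Fin 5`, integrand
`∏ⱼ base s (τ j) (xⱼ)`, elliptic coordinates in `(0,1)`, Cauchy coordinates over `ℝ` — and every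
vanishing `ℤ`-combination of such representations is a relation. (`s = 1/2` contains the route's
target `LemniscaticSectorKernel` up to coordinate reindexing, since `K' = K`, `E' = E` there.) -/
def PencilFibreKernel (s : ℚ) : Prop :=
  ∀ (ι : Type) [Fintype ι] (z : ι → ℤ) (N : ι → ℕ) (τ : ∀ i, Fin (N i) → Fin 5)
    (r : ∀ i, IntegralRep (N i)),
    (∀ i, (r i).domain = {x | ∀ j, τ i j ≠ 4 → x j ∈ Ioo (0:ℝ) 1}) →
    (∀ i, EqOn (r i).integrand (fun x => ∏ j, base (s : ℝ) (τ i j) (x j)) (r i).domain) →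
    eval (∑ i, z i • of (r i)) = 0 → (∑ i, z i • of (r i)) ∈ relations

/-- **NonCMFibreGlue** (the count at a non-CM fibre; pure algebra + Fubini plumbing, like
`LemniscaticSectorGlue`): algebraic independence of `K, K', E, E'` makes the fibre ring a GRAPH
sector (`π = 2(EK' + E'K − KK')`, coefficient `−1` on `π`: division over `ℤ`, no torsion issue),
so ONE generator transfer `LegendreAt s` closes it. -/
def NonCMFibreGlue : Prop :=
  ∀ s : ℚ, 0 < s → s < 1 →
    AlgebraicIndependent ℚ ![Kval s, Kval (1 - s), Eval s, Eval (1 - s)] →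
    LegendreAt s → PencilFibreKernel s

/-- `j`-invariant of the Legendre fibre `y² = (1 − x²)(1 − s x²)` (`λ = k² = s`). -/
def jInv (s : ℚ) : ℚ := 256 * (1 - s + s ^ 2) ^ 3 / (s ^ 2 * (1 - s) ^ 2)

/-- Elementary (ideator's computation, to be checked by the prover): for rational `s ∈ (0,1)` the
`j`-invariant is an integer only at `s = 1/2` (`s = a/b` coprime forces `a, b, b − a ∣ 16`). With the
classical integrality of CM `j`-invariants this makes `s = 1/2` the UNIQUE CM fibre of the rational pencil. -/
def JIntegralOnlyHalf : Prop :=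
  ∀ s : ℚ, 0 < s → s < 1 → (∃ n : ℤ, jInv s = n) → s = 1 / 2

/-- **LegendreDictionary** (support): Fresán's Conj. 10.4 (`EllipticPeriodsAlgIndep`, registered OPEN,
summit-implied by the barrier fact `kzConjecture_implies_ellipticPeriods_algIndep`) gives algebraic
independence of `K, K', E, E'` at every rational modulus `s ≠ 1/2`: Legendre ↔ Weierstrass period
dictionary (`ℚ̄(ω₁, ω₂, η₁, η₂) = ℚ̄(K, iK', E, iE')` up to algebraic factors), `NonCM` from
`j(s) ∉ ℤ` (`JIntegralOnlyHalf` + integrality of singular `j`, Silverman ATAEC II.6.1 — a cite fact). -/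
def LegendreDictionary : Prop :=
  Literature.Barriers.KontsevichZagierPeriods.EllipticPeriodsAlgIndep →
    ∀ s : ℚ, 0 < s → s < 1 → s ≠ 1 / 2 →
      AlgebraicIndependent ℚ ![Kval s, Kval (1 - s), Eval s, Eval (1 - s)]

/-- **LegendreDerivativeExact** (the new rules-level content): the `s`-derivative of the Legendre
integrand, integrated over the band `(0,1)² × [s₀, s₁]`, is a relation (value `0`; classical proof:
the derivative is a sum of exact `x`- and `y`-derivatives of ALGEBRAIC functions — Newton–Leibniz moves
with semialgebraic primitives, no logarithm). -/
def LegendreDerivativeExact : Prop :=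
  ∀ (s₀ s₁ : ℚ), 0 < s₀ → s₀ ≤ s₁ → s₁ < 1 → ∀ R : IntegralRep 3,
    R.domain = {w | w 0 ∈ Ioo (0:ℝ) 1 ∧ w 1 ∈ Ioo (0:ℝ) 1 ∧ (s₀ : ℝ) ≤ w 2 ∧ w 2 ≤ (s₁ : ℝ)} →
    EqOn R.integrand (fun w => deriv (fun s => legIntegrand s (w 0) (w 1)) (w 2)) R.domain →
    of R ∈ relations

/-- **LegendreUniform**: the whole pencil's Legendre relation from the route's crux 0280 (anchor at
`s = 1/2`) + `LegendreDerivativeExact` + one band Newton–Leibniz move in `s`. -/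
def LegendreUniform : Prop :=
  GpcLegendreLemniscatic → LegendreDerivativeExact → ∀ s : ℚ, 0 < s → s < 1 → LegendreAt s

/-- **RationalPencilKernel**: the glued split proposed for `SectorComplement` — the rational Legendre
pencil sector, lossless (conditional only on the summit-implied `EllipticPeriodsAlgIndep`). -/
def RationalPencilKernel : Prop := ∀ s : ℚ, 0 < s → s < 1 → PencilFibreKernel s

/-- The assembled implication of card 1 (first checkable statement of the line). -/
def PencilAssembly : Prop :=
  Literature.Barriers.KontsevichZagierPeriods.EllipticPeriodsAlgIndep →
    LegendreDictionary → NonCMFibreGlue → LegendreUniform → LegendreDerivativeExact →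
    GpcLegendreLemniscatic → PencilFibreKernel (1 / 2) → RationalPencilKernel

/-! ## §2 `relation-lattice-cofinality` -/

/-- **LinearCofinality** — motive-free typing of "every numerical relation is accessible", per finite
family: the lattice of `ℤ`-relations among the values of any finite family of representations is
contained in the `ℤ`-span of finitely many ACCESSIBLE relation vectors. Equivalent to the kernel form
(hence to the summit): `⇐` clear; `⇒` the relation lattice is finitely generated and each generator
has value `0`. -/
def LinearCofinality : Prop :=
  ∀ (ι : Type) [Fintype ι] (r : ι → Σ n, IntegralRep n),
    ∃ (κ : Type) (_ : Fintype κ) (ρ : κ → (ι → ℤ)),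
      (∀ k, (∑ i, ρ k i • of (r i).2) ∈ relations) ∧
      ∀ z : ι → ℤ, (∑ i, (z i : ℝ) * (r i).2.value) = 0 →
        z ∈ Submodule.span ℤ (Set.range ρ)

/-- **LatticeCountUpToTorsion** (pure linear algebra, the LINEAR currency: Baker / Huber–Wüstholz
lower bounds on `dim_ℚ span(values)`): accessible relation vectors `ρₖ` of `ℚ`-rank at least
`|ι| − dim_ℚ span_ℚ(values)` force every vanishing `ℤ`-combination into `relations` UP TO TORSION.
(Equality on the nose needs either torsion-freeness of `FormalRep ⧸ relations` or saturation of the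
accessible sublattice — see `containment-join`, Gauss-lemma criterion.) -/
def LatticeCountUpToTorsion : Prop :=
  ∀ (ι : Type) [Fintype ι] (r : ι → Σ n, IntegralRep n) (κ : Type) [Fintype κ] (ρ : κ → (ι → ℤ)),
    (∀ k, (∑ i, ρ k i • of (r i).2) ∈ relations) →
    Fintype.card ι ≤
      Module.finrank ℚ (Submodule.span ℚ (Set.range fun i => (r i).2.value)) +
        Module.finrank ℚ (Submodule.span ℚ (Set.range fun k => fun i => (ρ k i : ℚ))) →
    ∀ z : ι → ℤ, (∑ i, (z i : ℝ) * (r i).2.value) = 0 →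
      ∃ M : ℕ, M ≠ 0 ∧ M • (∑ i, z i • of (r i).2) ∈ relations

/-- **GraphIdealKernel** (pure commutative algebra, the ALGEBRAIC currency: Chudnovsky / Lindemann
trdeg lower bounds): over an algebraically independent tuple `v`, the ideal of relations of
`(v, G₁(v), …, G_h(v))` is the graph ideal `(y_j − G_j(x))`. Every sector closed or closable today is
a graph sector (lemniscatic: `π = 4KE − 2K²`; Legendre fibres; CM fibres: `K' = √D·K`, the `E`-relation;
weight 4: `ζ(4) = π⁴/90`, …). -/
def GraphIdealKernel : Prop :=
  ∀ (d h : ℕ) (v : Fin d → ℝ) (G : Fin h → MvPolynomial (Fin d) ℚ),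
    AlgebraicIndependent ℚ v →
    ∀ P : MvPolynomial (Fin d ⊕ Fin h) ℚ,
      MvPolynomial.aeval (Sum.elim v fun j => MvPolynomial.aeval v (G j)) P = 0 →
      P ∈ Ideal.span (Set.range fun j =>
        (MvPolynomial.X (Sum.inr j) : MvPolynomial (Fin d ⊕ Fin h) ℚ) -
          MvPolynomial.rename Sum.inl (G j))

/-- The transfer of card 2: `LinearCofinality` is an EQUIVALENT form of the summit. -/
def CofinalityTransfer : Prop := LinearCofinality ↔ KontsevichZagierPeriods

/-! ## §3 `containment-join` -/

/-- `H₁` with RATIONAL scalar factors on the monomial integrands (colouring form at `s = 1/2`; what the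
proof plan of `LemniscaticSectorGlue` yields verbatim, and the form a JOIN needs). -/
def LemniscaticSectorKernelQ : Prop :=
  ∀ (ι : Type) [Fintype ι] (z : ι → ℤ) (q : ι → ℚ) (N : ι → ℕ) (τ : ∀ i, Fin (N i) → Fin 5)
    (r : ∀ i, IntegralRep (N i)),
    (∀ i, (r i).domain = {x | ∀ j, τ i j ≠ 4 → x j ∈ Ioo (0:ℝ) 1}) →
    (∀ i, EqOn (r i).integrand (fun x => (q i : ℝ) * ∏ j, base (1 / 2 : ℝ) (τ i j) (x j)) (r i).domain) →
    eval (∑ i, z i • of (r i)) = 0 → (∑ i, z i • of (r i)) ∈ relations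

/-- The weight-`w` MZV simplex representation of the tree (`KZ.mzvRep`, analytic inputs discharged by
the tree's proved facts). -/
def mzv (s : List ℕ) (hs : MZV.IsAdmissible s) : IntegralRep (MZV.weight s) :=
  mzvRep s hs (mzvIntegrand_isSemialgebraicFunOn_holds s) (mzvIntegrand_integrableOn_holds s hs)

/-- **EulerContainment s q**: Euler's evaluation `ζ(s) = q·π^4` IN RULES FORM, booked as an
equivalence of SINGLE representations, the `π`-side scaled by `q` inside the integrand
(`[simplex, ω_s] ~ [ℝ⁴, q·∏ 1/(1+xⱼ²)]`); this booking lets move (1b) supply every rational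
rescaling, so no torsion hypothesis is ever needed downstream. -/
def EulerContainment (s : List ℕ) (hs : MZV.IsAdmissible s) (q : ℚ) : Prop :=
  ∀ m : IntegralRep 4, m.domain = univ →
    EqOn m.integrand (fun x => (q : ℝ) * ∏ j, 1 / (1 + x j ^ 2)) univ →
    Equivalent (mzv s hs) m

theorem adm4 : MZV.IsAdmissible [4] := by decide
theorem adm31 : MZV.IsAdmissible [3, 1] := by decide
theorem adm22 : MZV.IsAdmissible [2, 2] := by decide
theorem adm211 : MZV.IsAdmissible [2, 1, 1] := by decide

/-- **H2OfEuler** (answers Disproof.lean §7): the weight-4 probe `GpcZeta4Eq4zeta31` is a corollary of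
the two Euler containments `ζ(4) = π⁴/90`, `ζ(3,1) = π⁴/360` in rules form (then `H₂` is idle in the
crux by `Disproof.crux_iff_withoutH2_of`); it does NOT follow from `H₁` route-locally. -/
def H2OfEuler : Prop :=
  EulerContainment [4] adm4 (1 / 90) → EulerContainment [3, 1] adm31 (1 / 360) → GpcZeta4Eq4zeta31

/-- **JointKernelW4**: kernel form on the JOIN of the lemniscatic ring (rationally scaled monomials)
with the four weight-4 simplex representations. -/
def JointKernelW4 : Prop :=
  ∀ (ι : Type) [Fintype ι] (z : ι → ℤ) (q : ι → ℚ) (N : ι → ℕ) (τ : ∀ i, Fin (N i) → Fin 5)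
    (r : ∀ i, IntegralRep (N i)) (z₄ z₃₁ z₂₂ z₂₁₁ : ℤ),
    (∀ i, (r i).domain = {x | ∀ j, τ i j ≠ 4 → x j ∈ Ioo (0:ℝ) 1}) →
    (∀ i, EqOn (r i).integrand (fun x => (q i : ℝ) * ∏ j, base (1 / 2 : ℝ) (τ i j) (x j)) (r i).domain) →
    eval (∑ i, z i • of (r i) + z₄ • of (mzv [4] adm4) + z₃₁ • of (mzv [3, 1] adm31)
        + z₂₂ • of (mzv [2, 2] adm22) + z₂₁₁ • of (mzv [2, 1, 1] adm211)) = 0 →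
    (∑ i, z i • of (r i) + z₄ • of (mzv [4] adm4) + z₃₁ • of (mzv [3, 1] adm31)
        + z₂₂ • of (mzv [2, 2] adm22) + z₂₁₁ • of (mzv [2, 1, 1] adm211)) ∈ relations

/-- **ContainmentJoin** (first lemma of card 3): a closed sector absorbs any family of
representations contained in it along the `π`-line, at the cost of one containment chain each and
NO new transcendence input. -/
def ContainmentJoin : Prop :=
  LemniscaticSectorKernelQ →
    EulerContainment [4] adm4 (1 / 90) → EulerContainment [3, 1] adm31 (1 / 360) →
    EulerContainment [2, 2] adm22 (1 / 120) → EulerContainment [2, 1, 1] adm211 (1 / 90) →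
    JointKernelW4

end Summit.KontsevichZagierPeriods.KontsevichZagierPeriods.Cruxes.SectorComplement.SketchIdeator3
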